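import Literature.RepresentationTheory.FiniteGroups.GL2ModularPrincipalSeriesLatticeSocleModel
import Literature.RepresentationTheory.FiniteGroups.GL2ModularPrincipalSeriesCoordTwist
import HarnessLib

/-!
# The reduction image of a stable lattice of the tame principal-series type: the saturation / socle-quotient
# dichotomy, and the socle condition for the standard lattice

Topic `Literature/RepresentationTheory/FiniteGroups`, namespace `Literature.RepresentationTheory.FiniteGroups.GL2`.
Two plumbing definitions (`coordReduce`, `reductionSubrep`) + THEOREMS; no named fact, no instance, no notation, no
`sorry`.  Sequel of `GL2ModularPrincipalSeriesLatticeSocleModel` / `…LengthTwo` / `…Reduction`.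

Setting [SerreLinearRepresentations1977, §15.1–15.2 (reduction of a stable lattice modulo `𝔪`); EmertonGeeSavitt2015,
§3.2 and Lemma 4.1.1]: `R → k` an algebra onto a field of characteristic `p` with `ker = (ϖ)`, characters
`χ₁ χ₂ : 𝔽_pˣ → Rˣ` whose reductions satisfy `χ̄₁ ≠ χ̄₂ = χ̄₁ εʳ`, `r + s = p − 1`, and the STANDARD lattice
`L = (Option 𝔽_p → R)` of the type `Ind(χ₁ ⊗ χ₂)` in Bruhat coordinates (`coordRep χ₁ χ₂`), whose reduction
`L/ϖL = Fun_k(Ind(χ̄₁ ⊗ χ̄₂))` (`coordRep χ̄₁ χ̄₂`) is uniserial of length two with socle `Sym^r(k²) ⊗ (χ̄₁ ∘ det)`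
(tree: `eq_bot_or_eq_socle_or_eq_top`, `symPowSubrep_le_of_ne_bot`, `symPowTwistEquivSubrep`).  For a `GL₂(𝔽_p)`-stable
`R`-submodule `Λ' ⊆ L` of finite index (`ϖᵐ L ⊆ Λ'`) we prove the elementary facts about its image `Λ̄' ⊆ L/ϖL`
that the CONSUMER of the lattice theorem needs in order to VERIFY the socle hypothesis:

* `coordReduce k : L →ₗ[R] (Option 𝔽_p → k)` (coordinatewise `R → k`), `coordReduce_coordRep` (equivariance),
  `coordReduce_eq_zero_iff` (`ker = ϖL`), `coordReduce_surjective`;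
* `reductionSubrep` — the image `Λ̄'` as a subrepresentation of `coordRep χ̄₁ χ̄₂`;
* **`toSubmodule_eq_top_of_forall_exists_coordReduce_eq`** (Nakayama): `Λ̄' = L/ϖL ⟹ Λ' = L`;
* **`exists_surjective_symPowTwist_of_ne_top`**: if `Λ' ≠ L` and `Λ' ⊄ ϖL` then `Λ̄'` is the socle, so `Λ'` maps
  `R`-linearly, equivariantly and ONTO the simple module `Sym^r(k²) ⊗ (χ̄₁ ∘ det)` (`symPowTwist`) — the
  «socle-quotient» alternative;
* **`exists_injective_symPowTwist_of_toSubmodule_eq_top`**: the standard lattice itself satisfies the socle hypothesis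
  of the lattice theorem (`subrepresentation_coordRep_eq_pow_smul_top`): every nonzero stable `R`-submodule of `L/ϖL`
  (plain `R`-module quotient, group acting through representatives) receives `Sym^r(k²) ⊗ (χ̄₁ ∘ det)` injectively and
  equivariantly;
* `exists_eq_pow_smul_not_forall_dvd` — division of an `R`-linear map into `L` with finite-index image by the exact
  power of `ϖ` dividing it (`ϖ` regular, not a unit), and `coordVec_eq_of_pow_smul_eq` (cancellation in `L`).

Consumer: route BSD/TeichmullerTwistDescent, crux `TwistedPeriodLatticeSaturation`: these split the «integral tame-type
carrier functional» into a rational functional and a mod-`p` weight-exclusion statement.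

## References
* J.-P. Serre, *Linear Representations of Finite Groups* (1977), §15.1–15.2. [SerreLinearRepresentations1977]
* M. Emerton, T. Gee, D. Savitt, *Lattices in the cohomology of Shimura curves*, Invent. Math. 200 (2015), §3.2,
  Lemma 4.1.1. [EmertonGeeSavitt2015]
-/

noncomputable section

namespace Literature.RepresentationTheory.FiniteGroups

namespace GL2

open Function Pointwise

/-! ### Coordinatewise reduction of the standard lattice -/

section CoordReduce

variable {p : ℕ} [Fact p.Prime] {R : Type} [CommRing R] {k : Type} [CommRing k] [Algebra R k]
  (χ₁ χ₂ : (ZMod p)ˣ →* Rˣ)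

variable (k) in
/-- Coordinatewise reduction `(Option 𝔽_p → R) → (Option 𝔽_p → k)` of the Bruhat coordinates along `R → k`,
`R`-linear for the `R`-module structure of `k`. [cite: SerreLinearRepresentations1977, §15.2] -/
def coordReduce : (Option (ZMod p) → R) →ₗ[R] (Option (ZMod p) → k) where
  toFun v o := algebraMap R k (v o)
  map_add' v w := by
    funext o
    simp only [Pi.add_apply, map_add]
  map_smul' c v := by
    funext o
    simp only [Pi.smul_apply, smul_eq_mul, map_mul, RingHom.id_apply, Algebra.smul_def]

omit [Fact p.Prime] in
/-- Unfolding. [cite: SerreLinearRepresentations1977, §15.2] -/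
@[simp]
theorem coordReduce_apply (v : Option (ZMod p) → R) (o : Option (ZMod p)) :
    coordReduce k v o = algebraMap R k (v o) := rfl

/-- Reduction of `bruhatLift v` is `bruhatLift` of the reduced coordinates. [cite: SerreLinearRepresentations1977, §15.2] -/
theorem reduce_bruhatLift (v : Option (ZMod p) → R) :
    reduce k χ₁ χ₂ (bruhatLift χ₁ χ₂ v) = bruhatLift (reduceChar k χ₁) (reduceChar k χ₂) (coordReduce k v) := by
  apply (bruhatEquiv (reduceChar k χ₁) (reduceChar k χ₂)).injective
  funext o
  rw [bruhatEquiv_apply, bruhatEquiv_apply, bruhatEval_reduce, bruhatEval_bruhatLift, bruhatEval_bruhatLift,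
    coordReduce_apply]

/-- **The coordinate reduction is equivariant**: `red(g · v) = g · red(v)` for the coordinate models
`coordRep χ₁ χ₂` over `R` and `coordRep χ̄₁ χ̄₂` over `k`. [cite: SerreLinearRepresentations1977, §15.2] -/
theorem coordReduce_coordRep (g : GL (Fin 2) (ZMod p)) (v : Option (ZMod p) → R) :
    coordReduce k (coordRep χ₁ χ₂ g v) = coordRep (reduceChar k χ₁) (reduceChar k χ₂) g (coordReduce k v) := by
  funext o
  rw [coordReduce_apply, coordRep_apply, coordRep_apply, ← bruhatEval_reduce, ← reduce_bruhatLift]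
  rfl

omit [Fact p.Prime] in
/-- **Kernel of the coordinate reduction**: `red v = 0 ↔ v ∈ ϖL` when `ker (R → k) = (ϖ)`.
[cite: SerreLinearRepresentations1977, §15.2] -/
theorem coordReduce_eq_zero_iff {ϖ : R} (hker : ∀ a : R, algebraMap R k a = 0 ↔ ϖ ∣ a)
    (v : Option (ZMod p) → R) : coordReduce k v = 0 ↔ ∃ w : Option (ZMod p) → R, v = ϖ • w := by
  constructor
  · intro h
    have hd : ∀ o, ϖ ∣ v o := fun o => (hker _).mp (by simpa using congr_fun h o)
    choose w hw using hd
    exact ⟨w, funext fun o => by rw [Pi.smul_apply, smul_eq_mul, hw o]⟩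
  · rintro ⟨w, rfl⟩
    funext o
    rw [coordReduce_apply, Pi.smul_apply, smul_eq_mul, map_mul, (hker ϖ).mpr (dvd_refl ϖ), zero_mul,
      Pi.zero_apply]

omit [Fact p.Prime] in
/-- The coordinate reduction is onto when `R → k` is. [cite: SerreLinearRepresentations1977, §15.2] -/
theorem coordReduce_surjective (hsurj : Surjective (algebraMap R k)) :
    Surjective (coordReduce (p := p) (R := R) k) := by
  intro w
  choose v hv using fun o => hsurj (w o)
  exact ⟨v, funext fun o => by rw [coordReduce_apply, hv]⟩

omit [Fact p.Prime] in
/-- Cancellation of a regular element in the standard lattice: `ϖᶜ v = ϖᶜ w ⟹ v = w`.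
[cite: SerreLinearRepresentations1977, §15.2] -/
theorem coordVec_eq_of_pow_smul_eq {ϖ : R} (hreg : ∀ a : R, ϖ * a = 0 → a = 0) (c : ℕ)
    {v w : Option (ZMod p) → R} (h : ϖ ^ c • v = ϖ ^ c • w) : v = w := by
  induction c generalizing v w with
  | zero => simpa using h
  | succ c ih =>
    apply ih
    funext o
    have ho := congr_fun h o
    simp only [Pi.smul_apply, smul_eq_mul, pow_succ, mul_assoc] at ho
    have : ϖ * (ϖ ^ c * v o - ϖ ^ c * w o) = 0 := by rw [mul_sub, mul_left_comm, ho, mul_left_comm, sub_self]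
    have h2 := hreg _ this
    rw [Pi.smul_apply, Pi.smul_apply, smul_eq_mul, smul_eq_mul]
    exact sub_eq_zero.mp h2

omit [Fact p.Prime] in
/-- Cancellation of a regular element in the standard lattice: `ϖ v = ϖ w ⟹ v = w`.
[cite: SerreLinearRepresentations1977, §15.2] -/
theorem coordVec_eq_of_smul_eq {ϖ : R} (hreg : ∀ a : R, ϖ * a = 0 → a = 0)
    {v w : Option (ZMod p) → R} (h : ϖ • v = ϖ • w) : v = w :=
  coordVec_eq_of_pow_smul_eq hreg 1 (by rwa [pow_one])

end CoordReduce

/-! ### Division of a map into the standard lattice by the exact power of `ϖ` -/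

section Division

variable {p : ℕ} [Fact p.Prime] {R : Type} [CommRing R] {X : Type} [AddCommGroup X] [Module R X]

omit [Fact p.Prime] in
/-- **Division by the exact power of `ϖ`.**  Let `Ψ : X → L = (Option 𝔽_p → R)` be `R`-linear with image of finite
index (`ϖᵐ L ⊆ im Ψ`), `ϖ` regular and not a unit.  Then `Ψ = ϖᶜ Ψ₁` for an `R`-linear `Ψ₁` whose image is again of
finite index and NOT contained in `ϖL`. [cite: SerreLinearRepresentations1977, §15.1] -/
theorem exists_eq_pow_smul_not_forall_dvd {ϖ : R} (hreg : ∀ a : R, ϖ * a = 0 → a = 0) (hunit : ¬ IsUnit ϖ)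
    (Ψ : X →ₗ[R] (Option (ZMod p) → R)) {m : ℕ}
    (hm : ∀ v : Option (ZMod p) → R, ϖ ^ m • v ∈ LinearMap.range Ψ) :
    ∃ (c m₁ : ℕ) (Ψ₁ : X →ₗ[R] (Option (ZMod p) → R)), (∀ x, Ψ x = ϖ ^ c • Ψ₁ x) ∧
      (∀ v : Option (ZMod p) → R, ϖ ^ m₁ • v ∈ LinearMap.range Ψ₁) ∧ ¬ (∀ x o, ϖ ∣ Ψ₁ x o) := by
  induction m generalizing Ψ with
  | zero =>
    refine ⟨0, 0, Ψ, fun x => by rw [pow_zero, one_smul], hm, fun hdvd => hunit ?_⟩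
    -- `1 ∈ im Ψ ⊆ ϖL` forces `ϖ ∣ 1`
    obtain ⟨x, hx⟩ := hm (fun _ => 1)
    rw [pow_zero, one_smul] at hx
    have h1 : ϖ ∣ (1 : R) := by
      have := hdvd x none
      rwa [hx] at this
    exact isUnit_of_dvd_one h1
  | succ m ih =>
    by_cases hdvd : ∀ x o, ϖ ∣ Ψ x o
    · -- divide once
      choose q hq using hdvd
      have hq' : ∀ x, Ψ x = ϖ • q x := fun x => funext fun o => by rw [Pi.smul_apply, smul_eq_mul, hq x o]
      let Ψ' : X →ₗ[R] (Option (ZMod p) → R) :=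
        { toFun := q
          map_add' := fun x y => by
            apply coordVec_eq_of_smul_eq hreg
            rw [smul_add, ← hq', ← hq', ← hq', map_add]
          map_smul' := fun a x => by
            apply coordVec_eq_of_smul_eq hreg
            rw [RingHom.id_apply, smul_comm, ← hq', ← hq', map_smul] }
      have hΨ' : ∀ x, Ψ x = ϖ • Ψ' x := hq'
      have hm' : ∀ v : Option (ZMod p) → R, ϖ ^ m • v ∈ LinearMap.range Ψ' := by
        intro v
        obtain ⟨x, hx⟩ := hm v
        refine ⟨x, coordVec_eq_of_smul_eq hreg ?_⟩
        rw [← hΨ', hx, pow_succ', mul_smul]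
      obtain ⟨c, m₁, Ψ₁, h1, h2, h3⟩ := ih Ψ' hm'
      refine ⟨c + 1, m₁, Ψ₁, fun x => ?_, h2, h3⟩
      rw [hΨ', h1, pow_succ', mul_smul]
    · exact ⟨0, m + 1, Ψ, fun x => by rw [pow_zero, one_smul], hm, hdvd⟩

end Division

/-! ### The reduction image of a stable lattice and the saturation / socle-quotient dichotomy -/

section Image

variable (p : ℕ) [Fact p.Prime] {R : Type} [CommRing R] {k : Type} [Field k] [CharP k p] [Algebra R k]
  (χ₁ χ₂ : (ZMod p)ˣ →* Rˣ) {r s : ℕ}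

/-- **The reduction image `Λ̄' ⊆ L/ϖL`** of a stable `R`-submodule `Λ'` of the standard lattice, as a
subrepresentation of the mod-`ϖ` coordinate model `coordRep χ̄₁ χ̄₂` (`R → k` onto, so `R`-submodules of
`k`-spaces are `k`-subspaces). [cite: SerreLinearRepresentations1977, §15.2] -/
def reductionSubrep (hsurj : Surjective (algebraMap R k)) (Λ' : Subrepresentation (coordRep χ₁ χ₂)) :
    Subrepresentation (coordRep (reduceChar k χ₁) (reduceChar k χ₂)) where
  toSubmodule :=
    { carrier := coordReduce k '' (Λ' : Set (Option (ZMod p) → R))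
      add_mem' := by
        rintro _ _ ⟨v, hv, rfl⟩ ⟨w, hw, rfl⟩
        exact ⟨v + w, Λ'.toSubmodule.add_mem hv hw, map_add _ _ _⟩
      zero_mem' := ⟨0, Λ'.toSubmodule.zero_mem, map_zero _⟩
      smul_mem' := by
        rintro c _ ⟨v, hv, rfl⟩
        obtain ⟨a, rfl⟩ := hsurj c
        exact ⟨a • v, Λ'.toSubmodule.smul_mem a hv, by rw [map_smul, algebraMap_smul]⟩ }
  apply_mem_toSubmodule g := by
    rintro _ ⟨v, hv, rfl⟩
    exact ⟨coordRep χ₁ χ₂ g v, Λ'.apply_mem_toSubmodule g hv, coordReduce_coordRep χ₁ χ₂ g v⟩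

omit [CharP k p] in
/-- Membership in the reduction image. [cite: SerreLinearRepresentations1977, §15.2] -/
theorem mem_reductionSubrep_iff (hsurj : Surjective (algebraMap R k)) (Λ' : Subrepresentation (coordRep χ₁ χ₂))
    (w : Option (ZMod p) → k) : w ∈ reductionSubrep p χ₁ χ₂ hsurj Λ' ↔ ∃ v ∈ Λ', coordReduce k v = w :=
  Iff.rfl

/-- **The subrepresentations of the mod-`p` coordinate model are `0`, the socle, everything** (transport of
`eq_bot_or_eq_socle_or_eq_top` along the Bruhat isomorphism `coordEquiv`). [cite: EmertonGeeSavitt2015, §3.2] -/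
theorem coord_eq_bot_or_eq_socle_or_eq_top {ψ₁ ψ₂ : (ZMod p)ˣ →* kˣ} (hψne : ψ₁ ≠ ψ₂)
    (hψ : ∀ a : (ZMod p)ˣ, (ψ₂ a : k) = (ψ₁ a : k) * ZMod.castHom (dvd_refl p) k a ^ r) (hrs : r + s = p - 1)
    (S : Subrepresentation (coordRep ψ₁ ψ₂)) :
    S = ⊥ ∨ S = Subrepresentation.mapEquiv (coordEquiv ψ₁ ψ₂)
      (symPowSubrep (ZMod.castHom (dvd_refl p) k) ψ₁ ψ₂ r hψ) ∨ S = ⊤ := by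
  set Φ := Subrepresentation.mapEquiv (coordEquiv ψ₁ ψ₂) with hΦ
  rcases eq_bot_or_eq_socle_or_eq_top p hψne hψ hrs (Φ.symm S) with h | h | h
  · left
    rw [← Φ.apply_symm_apply S, h, OrderIso.map_bot]
  · right; left
    rw [← Φ.apply_symm_apply S, h]
  · right; right
    rw [← Φ.apply_symm_apply S, h, OrderIso.map_top]

/-- The coordinate socle lies in every nonzero subrepresentation of the mod-`p` coordinate model.
[cite: EmertonGeeSavitt2015, §3.2] -/
theorem coordSocle_le_of_ne_bot {ψ₁ ψ₂ : (ZMod p)ˣ →* kˣ} (hψne : ψ₁ ≠ ψ₂)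
    (hψ : ∀ a : (ZMod p)ˣ, (ψ₂ a : k) = (ψ₁ a : k) * ZMod.castHom (dvd_refl p) k a ^ r) (hr : r < p)
    (S : Subrepresentation (coordRep ψ₁ ψ₂)) (hS : S ≠ ⊥) :
    Subrepresentation.mapEquiv (coordEquiv ψ₁ ψ₂) (symPowSubrep (ZMod.castHom (dvd_refl p) k) ψ₁ ψ₂ r hψ) ≤ S := by
  set Φ := Subrepresentation.mapEquiv (coordEquiv ψ₁ ψ₂) with hΦ
  have hS' : Φ.symm S ≠ ⊥ := by
    intro h
    apply hS
    rw [← Φ.apply_symm_apply S, h, OrderIso.map_bot]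
  have hle := symPowSubrep_le_of_ne_bot p hψne hψ hr (Φ.symm S) hS'
  have := Φ.monotone hle
  rwa [OrderIso.apply_symm_apply] at this

omit [CharP k p] in
/-- **Saturation (Nakayama)**: a stable `R`-submodule `Λ'` of finite index in the standard lattice whose reduction
image is everything IS the standard lattice. [cite: SerreLinearRepresentations1977, §15.1] -/
theorem toSubmodule_eq_top_of_forall_exists_coordReduce_eq {ϖ : R}
    (hker : ∀ a : R, algebraMap R k a = 0 ↔ ϖ ∣ a) (Λ' : Subrepresentation (coordRep χ₁ χ₂)) {m : ℕ}
    (hm : ∀ v : Option (ZMod p) → R, ϖ ^ m • v ∈ Λ')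
    (hred : ∀ w : Option (ZMod p) → k, ∃ v ∈ Λ', coordReduce k v = w) : Λ'.toSubmodule = ⊤ := by
  -- every `v` is `u + ϖⁿ w` with `u ∈ Λ'`, for every `n`
  have key : ∀ (n : ℕ) (v : Option (ZMod p) → R), ∃ u ∈ Λ', ∃ w : Option (ZMod p) → R, v = u + ϖ ^ n • w := by
    intro n
    induction n with
    | zero => exact fun v => ⟨0, Λ'.toSubmodule.zero_mem, v, by rw [pow_zero, one_smul, zero_add]⟩
    | succ n ih =>
      intro v
      obtain ⟨u, hu, w, rfl⟩ := ih v
      obtain ⟨u', hu', hu'w⟩ := hred (coordReduce k w)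
      obtain ⟨w', hw'⟩ := (coordReduce_eq_zero_iff hker (w - u')).mp (by rw [map_sub, hu'w, sub_self])
      refine ⟨u + ϖ ^ n • u', Λ'.toSubmodule.add_mem hu (Λ'.toSubmodule.smul_mem _ hu'), w', ?_⟩
      rw [show w = u' + ϖ • w' by rw [← hw', add_sub_cancel], smul_add, pow_succ, mul_smul, add_assoc]
  refine eq_top_iff.mpr fun v _ => ?_
  obtain ⟨u, hu, w, rfl⟩ := key m v
  exact Λ'.toSubmodule.add_mem hu (hm w)

/-- **The socle-quotient alternative.**  `R → k` onto a field of characteristic `p` with `ker = (ϖ)`,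
`χ̄₁ ≠ χ̄₂ = χ̄₁εʳ`, `r + s = p − 1`.  A stable `R`-submodule `Λ'` of finite index in the standard lattice which is
NOT the whole lattice and NOT inside `ϖL` reduces onto the socle of `L/ϖL`; hence it maps `R`-linearly,
equivariantly and onto the simple module `Sym^r(k²) ⊗ (χ̄₁ ∘ det)`. [cite: EmertonGeeSavitt2015, §3.2]
[cite: SerreLinearRepresentations1977, §15.2] -/
theorem exists_surjective_symPowTwist_of_ne_top {ϖ : R}
    (hker : ∀ a : R, algebraMap R k a = 0 ↔ ϖ ∣ a) (hsurj : Surjective (algebraMap R k))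
    (hχne : reduceChar k χ₁ ≠ reduceChar k χ₂)
    (hχ : ∀ a : (ZMod p)ˣ, (reduceChar k χ₂ a : k) = (reduceChar k χ₁ a : k) * ZMod.castHom (dvd_refl p) k a ^ r)
    (hrs : r + s = p - 1)
    (Λ' : Subrepresentation (coordRep χ₁ χ₂)) {m : ℕ} (hm : ∀ v : Option (ZMod p) → R, ϖ ^ m • v ∈ Λ')
    (hne : Λ'.toSubmodule ≠ ⊤) (hnz : ∃ v ∈ Λ', coordReduce k v ≠ 0) :
    ∃ π : ↥Λ'.toSubmodule →ₗ[R] ↥(MvPolynomial.homogeneousSubmodule (Fin 2) k r), Surjective π ∧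
      ∀ (g : GL (Fin 2) (ZMod p)) (x : ↥Λ'.toSubmodule),
        π ⟨coordRep χ₁ χ₂ g x, Λ'.apply_mem_toSubmodule g x.2⟩ =
          symPowTwist (ZMod.castHom (dvd_refl p) k) (reduceChar k χ₁) r g (π x) := by
  have hp : 2 ≤ p := (Fact.out : p.Prime).two_le
  have hr : r < p := by omega
  let S := reductionSubrep p χ₁ χ₂ hsurj Λ'
  let Soc := Subrepresentation.mapEquiv (coordEquiv (reduceChar k χ₁) (reduceChar k χ₂))
    (symPowSubrep (ZMod.castHom (dvd_refl p) k) (reduceChar k χ₁) (reduceChar k χ₂) r hχ)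
  -- the image is the socle
  have hSsoc : S = Soc := by
    rcases coord_eq_bot_or_eq_socle_or_eq_top p hχne hχ hrs S with h | h | h
    · exfalso
      obtain ⟨v, hv, hv0⟩ := hnz
      have : coordReduce k v ∈ S := ⟨v, hv, rfl⟩
      rw [h] at this
      exact hv0 ((Submodule.mem_bot k).mp this)
    · exact h
    · exfalso
      apply hne
      apply toSubmodule_eq_top_of_forall_exists_coordReduce_eq p χ₁ χ₂ hker Λ' hm
      intro w
      have : w ∈ S := by rw [h]; exact Submodule.mem_top
      exact this
  -- the equivariant isomorphism `Sym^r ⊗ χ̄₁∘det ≃ Soc`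
  let e : (symPowTwist (ZMod.castHom (dvd_refl p) k) (reduceChar k χ₁) r).Equiv Soc.toRepresentation :=
    (symPowTwistEquivSubrep p hχ hr).trans
      (Subrepresentation.equivMapEquiv (coordEquiv (reduceChar k χ₁) (reduceChar k χ₂)) _)
  -- the reduction, corestricted to `Soc`, as an `R`-linear map on `Λ'`
  have hmem : ∀ x : ↥Λ'.toSubmodule, coordReduce k (x : Option (ZMod p) → R) ∈ Soc.toSubmodule := by
    intro x
    have : coordReduce k (x : Option (ZMod p) → R) ∈ S := ⟨(x : Option (ZMod p) → R), x.2, rfl⟩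
    rwa [hSsoc] at this
  let red : ↥Λ'.toSubmodule →ₗ[R] ↥Soc.toSubmodule :=
    { toFun := fun x => ⟨coordReduce k (x : Option (ZMod p) → R), hmem x⟩
      map_add' := fun x y => Subtype.ext (by simp only [Submodule.coe_add, map_add])
      map_smul' := fun a x => Subtype.ext (by
        simp only [Submodule.coe_smul, map_smul, RingHom.id_apply, Submodule.coe_smul_of_tower]) }
  have hred_surj : Surjective red := by
    intro y
    have hy : (y : Option (ZMod p) → k) ∈ S := by rw [hSsoc]; exact y.2
    obtain ⟨v, hv, hvy⟩ := hy
    exact ⟨⟨v, hv⟩, Subtype.ext hvy⟩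
  refine ⟨(e.symm.toLinearEquiv.toLinearMap.restrictScalars R).comp red, ?_, ?_⟩
  · exact e.symm.toLinearEquiv.surjective.comp hred_surj
  · intro g x
    change e.symm (red ⟨coordRep χ₁ χ₂ g x, _⟩) = symPowTwist _ _ r g (e.symm (red x))
    rw [← e.symm.apply_apply_eq g (red x)]
    congr 1
    apply Subtype.ext
    change coordReduce k (coordRep χ₁ χ₂ g (x : Option (ZMod p) → R)) =
      coordRep (reduceChar k χ₁) (reduceChar k χ₂) g (coordReduce k (x : Option (ZMod p) → R))
    exact coordReduce_coordRep χ₁ χ₂ g (x : Option (ZMod p) → R)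

/-- **The standard lattice satisfies the socle hypothesis of the lattice theorem.**  `R → k` onto a field of
characteristic `p` with `ker = (ϖ)`, `χ̄₁ ≠ χ̄₂ = χ̄₁εʳ`, `r < p`.  For a stable `Λ'` with `Λ' = L` (as an
`R`-submodule), every nonzero `GL₂(𝔽_p)`-stable `R`-submodule `N` of the plain reduction `Λ'/ϖΛ'` receives an
injective `R`-linear map from `Sym^r(k²)` with image in `N`, equivariant for `Sym^r ⊗ (χ̄₁ ∘ det)` through
representatives — verbatim the hypothesis `hsoc` of `subrepresentation_coordRep_eq_pow_smul_top`.
[cite: EmertonGeeSavitt2015, §3.2, Lemma 4.1.1] -/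
theorem exists_injective_symPowTwist_of_toSubmodule_eq_top {ϖ : R}
    (hker : ∀ a : R, algebraMap R k a = 0 ↔ ϖ ∣ a) (hsurj : Surjective (algebraMap R k))
    (hχne : reduceChar k χ₁ ≠ reduceChar k χ₂)
    (hχ : ∀ a : (ZMod p)ˣ, (reduceChar k χ₂ a : k) = (reduceChar k χ₁ a : k) * ZMod.castHom (dvd_refl p) k a ^ r)
    (hr : r < p) (Λ' : Subrepresentation (coordRep χ₁ χ₂)) (htop : Λ'.toSubmodule = ⊤)
    (N : Submodule R (↥Λ'.toSubmodule ⧸ (ϖ • Λ'.toSubmodule).comap Λ'.toSubmodule.subtype))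
    (hN : ∀ (g : GL (Fin 2) (ZMod p)) (x : ↥Λ'.toSubmodule), Submodule.Quotient.mk x ∈ N →
      Submodule.Quotient.mk (⟨coordRep χ₁ χ₂ g x, Λ'.apply_mem_toSubmodule g x.2⟩ : ↥Λ'.toSubmodule) ∈ N)
    (hN0 : N ≠ ⊥) :
    ∃ f : ↥(MvPolynomial.homogeneousSubmodule (Fin 2) k r) →ₗ[R]
        (↥Λ'.toSubmodule ⧸ (ϖ • Λ'.toSubmodule).comap Λ'.toSubmodule.subtype),
      Injective f ∧ LinearMap.range f ≤ N ∧
      ∀ (g : GL (Fin 2) (ZMod p)) (φ : ↥(MvPolynomial.homogeneousSubmodule (Fin 2) k r)) (x : ↥Λ'.toSubmodule),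
        Submodule.Quotient.mk x = f φ →
        Submodule.Quotient.mk (⟨coordRep χ₁ χ₂ g x, Λ'.apply_mem_toSubmodule g x.2⟩ : ↥Λ'.toSubmodule) =
          f (symPowTwist (ZMod.castHom (dvd_refl p) k) (reduceChar k χ₁) r g φ) := by
  classical
  -- the reduction `Λ'/ϖΛ' → L/ϖL`, a bijective `R`-linear map
  let K : Submodule R ↥Λ'.toSubmodule := (ϖ • Λ'.toSubmodule).comap Λ'.toSubmodule.subtype
  have hKle : K ≤ LinearMap.ker ((coordReduce k).comp Λ'.toSubmodule.subtype) := by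
    intro x hx
    have hx' : (x : Option (ZMod p) → R) ∈ ϖ • Λ'.toSubmodule := hx
    rw [← SetLike.mem_coe, Submodule.coe_pointwise_smul, Set.mem_smul_set] at hx'
    obtain ⟨y, -, hy⟩ := hx'
    rw [LinearMap.mem_ker, LinearMap.comp_apply, Submodule.subtype_apply, ← hy]
    exact (coordReduce_eq_zero_iff hker _).mpr ⟨y, rfl⟩
  let q : (↥Λ'.toSubmodule ⧸ K) →ₗ[R] (Option (ZMod p) → k) := K.liftQ _ hKle
  have hq_mk : ∀ x : ↥Λ'.toSubmodule, q (Submodule.Quotient.mk x) = coordReduce k (x : Option (ZMod p) → R) :=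
    fun x => rfl
  have hq_inj : Injective q := by
    rw [← LinearMap.ker_eq_bot, eq_bot_iff]
    intro z hz
    obtain ⟨x, rfl⟩ := Submodule.Quotient.mk_surjective K z
    rw [LinearMap.mem_ker, hq_mk] at hz
    obtain ⟨w, hw⟩ := (coordReduce_eq_zero_iff hker _).mp hz
    rw [Submodule.mem_bot, Submodule.Quotient.mk_eq_zero]
    change (x : Option (ZMod p) → R) ∈ ϖ • Λ'.toSubmodule
    rw [hw]
    exact Submodule.smul_mem_pointwise_smul w ϖ Λ'.toSubmodule (by rw [htop]; exact Submodule.mem_top)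
  have hq_surj : Surjective q := by
    intro w
    obtain ⟨v, hv⟩ := coordReduce_surjective (p := p) hsurj w
    exact ⟨Submodule.Quotient.mk ⟨v, by rw [htop]; exact Submodule.mem_top⟩, by rw [hq_mk, ← hv]⟩
  let qe : (↥Λ'.toSubmodule ⧸ K) ≃ₗ[R] (Option (ZMod p) → k) := LinearEquiv.ofBijective q ⟨hq_inj, hq_surj⟩
  have hqe : ∀ z, qe z = q z := fun _ => rfl
  have hq_equiv : ∀ (g : GL (Fin 2) (ZMod p)) (x : ↥Λ'.toSubmodule),
      q (Submodule.Quotient.mk ⟨coordRep χ₁ χ₂ g x, Λ'.apply_mem_toSubmodule g x.2⟩) =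
        coordRep (reduceChar k χ₁) (reduceChar k χ₂) g (q (Submodule.Quotient.mk x)) := by
    intro g x
    rw [hq_mk, hq_mk]
    exact coordReduce_coordRep χ₁ χ₂ g x
  -- the image of `N` in `L/ϖL`, a nonzero subrepresentation
  let S : Subrepresentation (coordRep (reduceChar k χ₁) (reduceChar k χ₂)) :=
    { toSubmodule :=
        { carrier := q '' (N : Set (↥Λ'.toSubmodule ⧸ K))
          add_mem' := by
            rintro _ _ ⟨z, hz, rfl⟩ ⟨z', hz', rfl⟩
            exact ⟨z + z', N.add_mem hz hz', map_add _ _ _⟩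
          zero_mem' := ⟨0, N.zero_mem, map_zero _⟩
          smul_mem' := by
            rintro c _ ⟨z, hz, rfl⟩
            obtain ⟨a, rfl⟩ := hsurj c
            exact ⟨a • z, N.smul_mem a hz, by rw [map_smul, algebraMap_smul]⟩ }
      apply_mem_toSubmodule := by
        rintro g _ ⟨z, hz, rfl⟩
        obtain ⟨x, rfl⟩ := Submodule.Quotient.mk_surjective K z
        exact ⟨_, hN g x hz, hq_equiv g x⟩ }
  have hS0 : S ≠ ⊥ := by
    intro hS
    apply hN0
    rw [eq_bot_iff]
    intro z hz
    have : q z ∈ S := ⟨z, hz, rfl⟩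
    rw [hS] at this
    have h0 : q z = 0 := (Submodule.mem_bot k).mp this
    rw [Submodule.mem_bot]
    exact hq_inj (by rw [h0, map_zero])
  have hSoc := coordSocle_le_of_ne_bot p hχne hχ hr S hS0
  -- the embedding `Sym^r ⊗ χ̄₁∘det ↪ L/ϖL` with image the coordinate socle
  let e : (symPowTwist (ZMod.castHom (dvd_refl p) k) (reduceChar k χ₁) r).Equiv
      (Subrepresentation.mapEquiv (coordEquiv (reduceChar k χ₁) (reduceChar k χ₂))
        (symPowSubrep (ZMod.castHom (dvd_refl p) k) (reduceChar k χ₁) (reduceChar k χ₂) r hχ)).toRepresentation :=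
    (symPowTwistEquivSubrep p hχ hr).trans
      (Subrepresentation.equivMapEquiv (coordEquiv (reduceChar k χ₁) (reduceChar k χ₂)) _)
  let ι : ↥(MvPolynomial.homogeneousSubmodule (Fin 2) k r) →ₗ[R] (Option (ZMod p) → k) :=
    ((Submodule.subtype _).restrictScalars R).comp (e.toLinearEquiv.toLinearMap.restrictScalars R)
  have hι : ∀ φ, ι φ = ((e φ : ↥(Subrepresentation.mapEquiv (coordEquiv (reduceChar k χ₁) (reduceChar k χ₂))
      (symPowSubrep (ZMod.castHom (dvd_refl p) k) (reduceChar k χ₁) (reduceChar k χ₂) r hχ)).toSubmodule) :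
        Option (ZMod p) → k) := fun _ => rfl
  have hι_inj : Injective ι := by
    intro φ ψ h
    rw [hι, hι] at h
    exact e.toLinearEquiv.injective (Subtype.ext h)
  refine ⟨qe.symm.toLinearMap.comp ι, ?_, ?_, ?_⟩
  · exact qe.symm.injective.comp hι_inj
  · rintro _ ⟨φ, rfl⟩
    have hφS : ι φ ∈ S := hSoc (by rw [hι]; exact (e φ).2)
    obtain ⟨z, hz, hzφ⟩ := hφS
    rw [LinearMap.comp_apply, LinearEquiv.coe_toLinearMap]
    have hzeq : qe.symm (ι φ) = z := qe.injective (by rw [LinearEquiv.apply_symm_apply, hqe, hzφ])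
    rw [hzeq]
    exact hz
  · intro g φ x hx
    apply qe.injective
    rw [LinearMap.comp_apply, LinearEquiv.coe_toLinearMap] at hx ⊢
    rw [LinearEquiv.apply_symm_apply, hqe, hq_equiv g x, ← hqe, hx, LinearEquiv.apply_symm_apply, hι, hι,
      e.apply_apply_eq g φ]
    rfl

/-! ### Appended: the dichotomy WITHOUT a finite-index hypothesis (Nakayama over a coefficient ring with `ϖ` in the
Jacobson radical), and division of a functional by the exact power of `ϖ` -/

omit [CharP k p] in
/-- **Saturation (Nakayama, Jacobson form)**: over a coefficient ring `R` with `ϖ` in the Jacobson radical (e.g. `R = ℤ_p`,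
`ϖ = p`) and `ker (R → k) = (ϖ)`, a stable `R`-submodule of the standard lattice whose reduction image is everything IS the
standard lattice — no finite-index hypothesis (the standard lattice is finitely generated). [cite: SerreLinearRepresentations1977, §15.1] -/
theorem toSubmodule_eq_top_of_forall_exists_coordReduce_eq_of_jacobson {ϖ : R}
    (hker : ∀ a : R, algebraMap R k a = 0 ↔ ϖ ∣ a) (hjac : Ideal.span {ϖ} ≤ (⊥ : Ideal R).jacobson)
    (Λ' : Subrepresentation (coordRep χ₁ χ₂))
    (hred : ∀ w : Option (ZMod p) → k, ∃ v ∈ Λ', coordReduce k v = w) : Λ'.toSubmodule = ⊤ := by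
  -- `L = Λ' + ϖL`
  have hsum : ∀ v : Option (ZMod p) → R, ∃ u ∈ Λ', ∃ w : Option (ZMod p) → R, v = u + ϖ • w := by
    intro v
    obtain ⟨u, hu, huv⟩ := hred (coordReduce k v)
    obtain ⟨w, hw⟩ := (coordReduce_eq_zero_iff hker (v - u)).mp (by rw [map_sub, huv, sub_self])
    exact ⟨u, hu, w, by rw [← hw, add_sub_cancel]⟩
  -- Nakayama in the quotient `L/Λ'`
  let Q := (Option (ZMod p) → R) ⧸ Λ'.toSubmodule
  have htop : (⊤ : Submodule R Q) ≤ Ideal.span {ϖ} • (⊤ : Submodule R Q) := by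
    rintro q -
    obtain ⟨v, rfl⟩ := Submodule.Quotient.mk_surjective Λ'.toSubmodule q
    obtain ⟨u, hu, w, rfl⟩ := hsum v
    have : Submodule.Quotient.mk (p := Λ'.toSubmodule) (u + ϖ • w) =
        ϖ • Submodule.Quotient.mk (p := Λ'.toSubmodule) w := by
      rw [Submodule.Quotient.mk_add, (Submodule.Quotient.mk_eq_zero _).mpr hu, zero_add, Submodule.Quotient.mk_smul]
    rw [this]
    exact Submodule.smul_mem_smul (Ideal.mem_span_singleton_self ϖ) Submodule.mem_top
  have hfg : (⊤ : Submodule R Q).FG := Module.finite_def.mp inferInstance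
  have hbot : (⊤ : Submodule R Q) = ⊥ := Submodule.eq_bot_of_le_smul_of_le_jacobson_bot _ _ hfg htop hjac
  rw [eq_top_iff]
  intro v _
  have hv : Submodule.Quotient.mk (p := Λ'.toSubmodule) v ∈ (⊤ : Submodule R Q) := Submodule.mem_top
  rw [hbot, Submodule.mem_bot, Submodule.Quotient.mk_eq_zero] at hv
  exact hv

/-- **The socle-quotient alternative from the reduction image alone**: if the reduction image `Λ̄'` of a stable
`R`-submodule of the standard lattice is neither `0` nor everything, then it is the socle, and `Λ'` maps `R`-linearly,
equivariantly and ONTO `Sym^r(k²) ⊗ (χ̄₁ ∘ det)` (no finite-index hypothesis). [cite: EmertonGeeSavitt2015, §3.2]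
[cite: SerreLinearRepresentations1977, §15.2] -/
theorem exists_surjective_symPowTwist_of_reduction_ne (hsurj : Surjective (algebraMap R k))
    (hχne : reduceChar k χ₁ ≠ reduceChar k χ₂)
    (hχ : ∀ a : (ZMod p)ˣ, (reduceChar k χ₂ a : k) = (reduceChar k χ₁ a : k) * ZMod.castHom (dvd_refl p) k a ^ r)
    (hrs : r + s = p - 1) (Λ' : Subrepresentation (coordRep χ₁ χ₂))
    (hnz : ∃ v ∈ Λ', coordReduce k v ≠ 0) (hnt : ∃ w : Option (ZMod p) → k, ∀ v ∈ Λ', coordReduce k v ≠ w) :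
    ∃ π : ↥Λ'.toSubmodule →ₗ[R] ↥(MvPolynomial.homogeneousSubmodule (Fin 2) k r), Surjective π ∧
      ∀ (g : GL (Fin 2) (ZMod p)) (x : ↥Λ'.toSubmodule),
        π ⟨coordRep χ₁ χ₂ g x, Λ'.apply_mem_toSubmodule g x.2⟩ =
          symPowTwist (ZMod.castHom (dvd_refl p) k) (reduceChar k χ₁) r g (π x) := by
  have hp : 2 ≤ p := (Fact.out : p.Prime).two_le
  have hr : r < p := by omega
  let S := reductionSubrep p χ₁ χ₂ hsurj Λ'
  let Soc := Subrepresentation.mapEquiv (coordEquiv (reduceChar k χ₁) (reduceChar k χ₂))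
    (symPowSubrep (ZMod.castHom (dvd_refl p) k) (reduceChar k χ₁) (reduceChar k χ₂) r hχ)
  have hSsoc : S = Soc := by
    rcases coord_eq_bot_or_eq_socle_or_eq_top p hχne hχ hrs S with h | h | h
    · exfalso
      obtain ⟨v, hv, hv0⟩ := hnz
      have : coordReduce k v ∈ S := ⟨v, hv, rfl⟩
      rw [h] at this
      exact hv0 ((Submodule.mem_bot k).mp this)
    · exact h
    · exfalso
      obtain ⟨w, hw⟩ := hnt
      have : w ∈ S := by rw [h]; exact Submodule.mem_top
      obtain ⟨v, hv, hvw⟩ := this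
      exact hw v hv hvw
  let e : (symPowTwist (ZMod.castHom (dvd_refl p) k) (reduceChar k χ₁) r).Equiv Soc.toRepresentation :=
    (symPowTwistEquivSubrep p hχ hr).trans
      (Subrepresentation.equivMapEquiv (coordEquiv (reduceChar k χ₁) (reduceChar k χ₂)) _)
  have hmem : ∀ x : ↥Λ'.toSubmodule, coordReduce k (x : Option (ZMod p) → R) ∈ Soc.toSubmodule := by
    intro x
    have : coordReduce k (x : Option (ZMod p) → R) ∈ S := ⟨(x : Option (ZMod p) → R), x.2, rfl⟩
    rwa [hSsoc] at this
  let red : ↥Λ'.toSubmodule →ₗ[R] ↥Soc.toSubmodule :=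
    { toFun := fun x => ⟨coordReduce k (x : Option (ZMod p) → R), hmem x⟩
      map_add' := fun x y => Subtype.ext (by simp only [Submodule.coe_add, map_add])
      map_smul' := fun a x => Subtype.ext (by
        simp only [Submodule.coe_smul, map_smul, RingHom.id_apply, Submodule.coe_smul_of_tower]) }
  have hred_surj : Surjective red := by
    intro y
    have hy : (y : Option (ZMod p) → k) ∈ S := by rw [hSsoc]; exact y.2
    obtain ⟨v, hv, hvy⟩ := hy
    exact ⟨⟨v, hv⟩, Subtype.ext hvy⟩
  refine ⟨(e.symm.toLinearEquiv.toLinearMap.restrictScalars R).comp red, ?_, ?_⟩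
  · exact e.symm.toLinearEquiv.surjective.comp hred_surj
  · intro g x
    change e.symm (red ⟨coordRep χ₁ χ₂ g x, _⟩) = symPowTwist _ _ r g (e.symm (red x))
    rw [← e.symm.apply_apply_eq g (red x)]
    congr 1
    apply Subtype.ext
    change coordReduce k (coordRep χ₁ χ₂ g (x : Option (ZMod p) → R)) =
      coordRep (reduceChar k χ₁) (reduceChar k χ₂) g (coordReduce k (x : Option (ZMod p) → R))
    exact coordReduce_coordRep χ₁ χ₂ g (x : Option (ZMod p) → R)

end Image

/-! ### Division of an `R`-valued functional by the exact power of `ϖ` -/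

section FunctionalDivision

variable {R : Type} [CommRing R] {X : Type} [AddCommGroup X] [Module R X]

/-- **Division of a functional by the exact power of `ϖ`**: if `ϖ` is regular and `⋂ⱼ ϖʲR = 0`, a NONZERO `R`-linear
functional `λ : X → R` is `ϖᶜ λ₁` with `λ₁` PRIMITIVE (some value not divisible by `ϖ`); `λ₁` vanishes wherever `λ` does.
[cite: SerreLinearRepresentations1977, §15.1] -/
theorem exists_eq_pow_smul_primitive {ϖ : R} (hreg : ∀ a : R, ϖ * a = 0 → a = 0)
    (hsep : ∀ a : R, (∀ j : ℕ, ϖ ^ j ∣ a) → a = 0) (lam : X →ₗ[R] R) (hlam : lam ≠ 0) :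
    ∃ (c : ℕ) (lam₁ : X →ₗ[R] R), (∀ x, lam x = ϖ ^ c * lam₁ x) ∧ (∃ x, ¬ ϖ ∣ lam₁ x) ∧
      ∀ x, lam x = 0 → lam₁ x = 0 := by
  -- a value of finite `ϖ`-adic order
  obtain ⟨x₀, hx₀⟩ : ∃ x₀, lam x₀ ≠ 0 := by
    by_contra h
    push Not at h
    exact hlam (LinearMap.ext fun x => by rw [h x, LinearMap.zero_apply])
  obtain ⟨n, hn⟩ : ∃ n : ℕ, ¬ ϖ ^ n ∣ lam x₀ := by
    by_contra h
    push Not at h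
    exact hx₀ (hsep _ h)
  -- induction on the order bound `n`, for all functionals
  induction n generalizing lam with
  | zero => exact absurd (by rw [pow_zero]; exact one_dvd _) hn
  | succ n ih =>
    by_cases hprim : ∃ x, ¬ ϖ ∣ lam x
    · exact ⟨0, lam, fun x => by rw [pow_zero, one_mul], hprim, fun x hx => hx⟩
    · push Not at hprim
      choose q hq using hprim
      let lam' : X →ₗ[R] R :=
        { toFun := q
          map_add' := fun x y => sub_eq_zero.mp (hreg _ (by
            have h := map_add lam x y
            rw [hq (x + y), hq x, hq y] at h
            rw [mul_sub, mul_add, h, sub_self]))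
          map_smul' := fun a x => sub_eq_zero.mp (hreg _ (by
            have h := map_smul lam a x
            rw [smul_eq_mul, hq (a • x), hq x] at h
            rw [RingHom.id_apply, smul_eq_mul, mul_sub, h, mul_left_comm, sub_self])) }
      have hlam' : ∀ x, lam x = ϖ * lam' x := hq
      have hne' : lam' ≠ 0 := by
        intro h
        apply hx₀
        rw [hlam', h, LinearMap.zero_apply, mul_zero]
      have hx₀' : lam' x₀ ≠ 0 := by
        intro h
        apply hx₀
        rw [hlam', h, mul_zero]
      have hn' : ¬ ϖ ^ n ∣ lam' x₀ := by
        intro h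
        apply hn
        rw [hlam', pow_succ']
        exact mul_dvd_mul_left ϖ h
      obtain ⟨c, lam₁, h1, h2, h3⟩ := ih lam' hne' hx₀' hn'
      refine ⟨c + 1, lam₁, fun x => ?_, h2, fun x hx => h3 x (hreg _ ?_)⟩
      · rw [hlam', h1, pow_succ', mul_assoc]
      · rw [← hlam', hx]

end FunctionalDivision

end GL2

end Literature.RepresentationTheory.FiniteGroups
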